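import Summits.AnomalousDissipation.AnomalousDissipation.Theorems.SolenoidalFractalHomogenisationLagrangianStepSidebandLadderSigned
import HarnessLib

/-!
# K1L_D `stub_D1_V0thg` (stmt-AnomalousDissipation-27980), R3′ lane «SidebandTailCrushing» (tenure D28-16 (3) / D28-20) — file F4d(ii):
# LADDER COERCIVITY — hypothesis (U) `h5` (uncertainty inequality with the free ε) of the hypocoercivity lemma, box ends included

Helper file of route `SolenoidalFractalHomogenisation` (prover seat `ad-k1l-cellLawV-w1` g10; plan memo
`Cruxes/LagrangianRenormalisationStepDesign/Lines/onelevel-vtheta-R3-plan.md` §3 (S)(U); `--supports stmt-AnomalousDissipation-27980 --as helper`).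
For a HOPPING ladder `L = z₀ + ℤmᵢ` (`êᵢ·z₀ ≠ 0`, hence every `z ∈ L` has `êᵢ·z ≠ 0`, so `z ≠ 0`, `z ± mᵢ ≠ 0`), a state `y ∈ ladderSub R L`, `K = indexL`,
`H = hopL`, `C = K H − H K`, `a = 2π|êᵢ·z₀|‖αᵢ‖`, `NearIso 𝔸 lo' hi'` (`lo' > 0`) and a box radius `R > M ≥ ‖mᵢ‖_∞`:
* (S) — `siteIndex_mul_zdot_nonneg`, `sq_le_freqNormSq_of_add/sub_not_mem`, `signed_site_box`, `inner_indexL_commutator_ge` (the `η` below) — is file F4d(i)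
  `…SidebandLadderSigned`;
* `norm_sq_hopL_le` (`‖Hy‖² ≤ 4a²‖y‖²`), `norm_sq_hopL_eq` (`‖Hy‖² = ‖Cy‖² + 2⟪Cy, H(Ky)⟫ − ⟪Ky,[C,H]y⟫`, from `[K,C] = H`);
* **(U) `coercive_ladder`**: for every `ε > 0`,
  `‖y‖² ≤ ((1+|mᵢ|²)/(4a²))·((2 + 2a²/ε)‖Cy‖² + 2ε‖Ky‖² + (η + 4a²/((1+|mᵢ|²)·4π²lo'(R−M)²))·⟪dampL y,y⟫)` — F2 `uncertainty_site_lattice` summed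
  over the interior, box ends absorbed; the free `ε` is load-bearing (certifier 3-probe: the enhancement lives in the small-`ε` member).
No definitions, no sorry.  NOT a proof of `stub_D1_V0thg`, of K1L_D or of AD; rung F-D1.A0 infrastructure.
-/

set_option linter.dupNamespace false -- single-conjunct summit: `Summit.AnomalousDissipation.AnomalousDissipation.…` is the mandated namespace

noncomputable section

namespace Summit.AnomalousDissipation.AnomalousDissipation.Theorems.SolenoidalFractalHomogenisation.LagrangianStep.Sideband

open Set Complex
open scoped InnerProductSpace
open Literature.Analysis Literature.Analysis.FunctionSpaces Literature.Analysis.FunctionSpaces.Torus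
open Literature.Analysis.FluidPDE Literature.Analysis.FluidPDE.Torus Literature.Analysis.FluidPDE.LatticeShear
open Summit.AnomalousDissipation.AnomalousDissipation.Theorems.SolenoidalFractalHomogenisation.LagrangianStep.CellChain
  (linkCoeff kdot_transversalProj' inner_transversalProj_left_of_kdot_eq_zero norm_transversalProj_le)
open Summit.AnomalousDissipation.AnomalousDissipation.Theorems.SolenoidalFractalHomogenisation.LagrangianStep.W7Slot (dot_sq_le_freqNormSq_mul)

variable {k₀ : ℕ}

/-! ## §3 (U) Coercivity on the ladder subspace -/

/-- `‖Hy‖² ≤ 4a²‖y‖²` on the ladder subspace (`a = 2π|êᵢ·z₀|‖αᵢ‖`). [cite: MeshalkinSinai1961, pp. 1700–1705] -/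
theorem norm_sq_hopL_le (W₁ : LatticeWord k₀) {R : ℕ} (i : Fin k₀) (z₀ : Fin 3 → ℤ) {y : Space R}
    (hy : y ∈ ladderSub R (ladder z₀ (W₁.phase i).m)) :
    ‖hopL W₁ R i y‖ ^ 2 ≤ 4 * (2 * Real.pi * |∑ a, (W₁.phase i).e a * (z₀ a : ℝ)| * ‖slotAmp W₁ i‖) ^ 2 * ‖y‖ ^ 2 := by
  have h := norm_sq_hopL_add_norm_sq_bond W₁ i z₀ hy
  have hC : 0 ≤ ‖indexL R (W₁.phase i).m (hopL W₁ R i y) - hopL W₁ R i (indexL R (W₁.phase i).m y)‖ ^ 2 := sq_nonneg _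
  have hterm : ∀ w : box R, ((if w.1 + (W₁.phase i).m ∈ box R then ‖transversalProj (w.1 + (W₁.phase i).m) (y w)‖ ^ 2 else 0) +
      (if w.1 - (W₁.phase i).m ∈ box R then ‖transversalProj (w.1 - (W₁.phase i).m) (y w)‖ ^ 2 else 0)) ≤ 2 * ‖y w‖ ^ 2 := by
    intro w
    have h1 : (if w.1 + (W₁.phase i).m ∈ box R then ‖transversalProj (w.1 + (W₁.phase i).m) (y w)‖ ^ 2 else 0) ≤ ‖y w‖ ^ 2 := by
      split_ifs
      · exact pow_le_pow_left₀ (norm_nonneg _) (norm_transversalProj_le _ _) 2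
      · positivity
    have h2 : (if w.1 - (W₁.phase i).m ∈ box R then ‖transversalProj (w.1 - (W₁.phase i).m) (y w)‖ ^ 2 else 0) ≤ ‖y w‖ ^ 2 := by
      split_ifs
      · exact pow_le_pow_left₀ (norm_nonneg _) (norm_transversalProj_le _ _) 2
      · positivity
    linarith
  have hsum := Finset.sum_le_sum fun w (_ : w ∈ Finset.univ) => hterm w
  rw [← Finset.mul_sum, ← PiLp.norm_sq_eq_of_L2] at hsum
  have ha : 0 ≤ 2 * (2 * Real.pi * |∑ a, (W₁.phase i).e a * (z₀ a : ℝ)| * ‖slotAmp W₁ i‖) ^ 2 := by positivity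
  nlinarith [mul_le_mul_of_nonneg_left hsum ha]

/-- **`‖Hy‖² = ‖Cy‖² + 2⟪Cy, H(Ky)⟫ − ⟪Ky, C(Hy) − H(Cy)⟫`** for every state (from `[K,C] = H`, `H` skew, `K`, `C` symmetric).
[cite: BedrossianCotiZelati2017, §2] -/
theorem norm_sq_hopL_eq (W₁ : LatticeWord k₀) {R : ℕ} (i : Fin k₀) (y : Space R) :
    ‖hopL W₁ R i y‖ ^ 2 = ‖indexL R (W₁.phase i).m (hopL W₁ R i y) - hopL W₁ R i (indexL R (W₁.phase i).m y)‖ ^ 2 +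
      2 * ⟪indexL R (W₁.phase i).m (hopL W₁ R i y) - hopL W₁ R i (indexL R (W₁.phase i).m y), hopL W₁ R i (indexL R (W₁.phase i).m y)⟫_ℝ -
      ⟪indexL R (W₁.phase i).m y,
        (indexL R (W₁.phase i).m (hopL W₁ R i (hopL W₁ R i y)) - hopL W₁ R i (indexL R (W₁.phase i).m (hopL W₁ R i y))) -
          hopL W₁ R i (indexL R (W₁.phase i).m (hopL W₁ R i y) - hopL W₁ R i (indexL R (W₁.phase i).m y))⟫_ℝ := by
  have hm := zdot_self_ne_zero W₁ i
  -- [K,C] = H as vectors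
  have hKC : indexL R (W₁.phase i).m (indexL R (W₁.phase i).m (hopL W₁ R i y) - hopL W₁ R i (indexL R (W₁.phase i).m y)) -
      (indexL R (W₁.phase i).m (hopL W₁ R i (indexL R (W₁.phase i).m y)) -
        hopL W₁ R i (indexL R (W₁.phase i).m (indexL R (W₁.phase i).m y))) = hopL W₁ R i y := by
    ext z : 1
    exact indexL_bond_sub_apply W₁ R i hm y z
  have hKs : ∀ u v : Space R, ⟪indexL R (W₁.phase i).m u, v⟫_ℝ = ⟪u, indexL R (W₁.phase i).m v⟫_ℝ :=
    fun u v => real_inner_diagL_comm R _ u v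
  have hHs : ∀ u v : Space R, ⟪hopL W₁ R i u, v⟫_ℝ = -⟪u, hopL W₁ R i v⟫_ℝ := fun u v => real_inner_hopL_comm W₁ R i u v
  have hCs : ∀ u v : Space R, ⟪u, indexL R (W₁.phase i).m (hopL W₁ R i v) - hopL W₁ R i (indexL R (W₁.phase i).m v)⟫_ℝ =
      ⟪indexL R (W₁.phase i).m (hopL W₁ R i u) - hopL W₁ R i (indexL R (W₁.phase i).m u), v⟫_ℝ := by
    intro u v
    have a1 := hKs u (hopL W₁ R i v)
    have a2 := hHs (indexL R (W₁.phase i).m u) v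
    have a3 := hHs u (indexL R (W₁.phase i).m v)
    have a4 := hKs (hopL W₁ R i u) v
    rw [inner_sub_right, inner_sub_left]
    linarith
  -- abbreviations as plain terms
  have e0 : ‖hopL W₁ R i y‖ ^ 2 = ⟪indexL R (W₁.phase i).m (indexL R (W₁.phase i).m (hopL W₁ R i y) - hopL W₁ R i (indexL R (W₁.phase i).m y)) -
      (indexL R (W₁.phase i).m (hopL W₁ R i (indexL R (W₁.phase i).m y)) -
        hopL W₁ R i (indexL R (W₁.phase i).m (indexL R (W₁.phase i).m y))), hopL W₁ R i y⟫_ℝ := by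
    rw [hKC, real_inner_self_eq_norm_sq]
  -- ⟪K(Cy) − C(Ky), Hy⟫ = ⟪Cy, K(Hy)⟫ − ⟪Ky, C(Hy)⟫
  have b1 := hKs (indexL R (W₁.phase i).m (hopL W₁ R i y) - hopL W₁ R i (indexL R (W₁.phase i).m y)) (hopL W₁ R i y)
  have b2 := hCs (indexL R (W₁.phase i).m y) (hopL W₁ R i y)
  -- K(Hy) = Cy + H(Ky)
  have b4 : ⟪indexL R (W₁.phase i).m (hopL W₁ R i y) - hopL W₁ R i (indexL R (W₁.phase i).m y), indexL R (W₁.phase i).m (hopL W₁ R i y)⟫_ℝ =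
      ‖indexL R (W₁.phase i).m (hopL W₁ R i y) - hopL W₁ R i (indexL R (W₁.phase i).m y)‖ ^ 2 +
        ⟪indexL R (W₁.phase i).m (hopL W₁ R i y) - hopL W₁ R i (indexL R (W₁.phase i).m y), hopL W₁ R i (indexL R (W₁.phase i).m y)⟫_ℝ := by
    rw [← real_inner_self_eq_norm_sq, ← inner_add_right, sub_add_cancel]
  -- ⟪Ky, C(Hy)⟫ = ⟪Ky,[C,H]y⟫ + ⟪Ky, H(Cy)⟫ and ⟪Ky,H(Cy)⟫ = −⟪H(Ky), Cy⟫
  have b5 : ⟪indexL R (W₁.phase i).m y, indexL R (W₁.phase i).m (hopL W₁ R i (hopL W₁ R i y)) - hopL W₁ R i (indexL R (W₁.phase i).m (hopL W₁ R i y))⟫_ℝ =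
      ⟪indexL R (W₁.phase i).m y,
        (indexL R (W₁.phase i).m (hopL W₁ R i (hopL W₁ R i y)) - hopL W₁ R i (indexL R (W₁.phase i).m (hopL W₁ R i y))) -
          hopL W₁ R i (indexL R (W₁.phase i).m (hopL W₁ R i y) - hopL W₁ R i (indexL R (W₁.phase i).m y))⟫_ℝ +
      ⟪indexL R (W₁.phase i).m y, hopL W₁ R i (indexL R (W₁.phase i).m (hopL W₁ R i y) - hopL W₁ R i (indexL R (W₁.phase i).m y))⟫_ℝ := by
    rw [← inner_add_right, sub_add_cancel]
  have b6 := hHs (indexL R (W₁.phase i).m y) (indexL R (W₁.phase i).m (hopL W₁ R i y) - hopL W₁ R i (indexL R (W₁.phase i).m y))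
  have b7 := real_inner_comm (hopL W₁ R i (indexL R (W₁.phase i).m y)) (indexL R (W₁.phase i).m (hopL W₁ R i y) - hopL W₁ R i (indexL R (W₁.phase i).m y))
  rw [e0, inner_sub_left, b1, ← b2, b4, b5]
  linarith [b6, b7]

/-- **(U) per site**: on a hopping ladder in a box of radius `R > M ≥ ‖mᵢ‖_∞`, for every retained `w`,
`(2/(1+|m|²))·(‖y_w‖² − |w|²‖y_w‖²/(R−M)²) ≤ [w+m ∈ box]‖P_{w+m}y_w‖² + [w−m ∈ box]‖P_{w−m}y_w‖²` (interior: F2 `uncertainty_site_lattice`;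
box ends: the weight pays). [cite: BedrossianCotiZelati2017, §2 (spectral gap / uncertainty step)] -/
theorem uncertainty_site_box (W₁ : LatticeWord k₀) {R : ℕ} (i : Fin k₀) (z₀ : Fin 3 → ℤ)
    (hhop : ∑ a, (W₁.phase i).e a * (z₀ a : ℝ) ≠ 0) {M : ℝ} (hM : ∀ j, |((W₁.phase i).m j : ℝ)| ≤ M) (hMR : M < R)
    {y : Space R} (hy : y ∈ ladderSub R (ladder z₀ (W₁.phase i).m)) (w : box R) :
    2 / (1 + freqNormSq (W₁.phase i).m) * (‖y w‖ ^ 2 - freqNormSq w.1 * ‖y w‖ ^ 2 / ((R : ℝ) - M) ^ 2) ≤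
      (if w.1 + (W₁.phase i).m ∈ box R then ‖transversalProj (w.1 + (W₁.phase i).m) (y w)‖ ^ 2 else 0) +
        (if w.1 - (W₁.phase i).m ∈ box R then ‖transversalProj (w.1 - (W₁.phase i).m) (y w)‖ ^ 2 else 0) := by
  have hRM : 0 < (R : ℝ) - M := by linarith
  have hM2 := freqNormSq_nonneg (W₁.phase i).m
  have hc : 0 ≤ 2 / (1 + freqNormSq (W₁.phase i).m) := by positivity
  have hc1 : 2 / (1 + freqNormSq (W₁.phase i).m) ≤ 2 := by
    rw [div_le_iff₀ (by positivity)]; nlinarith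
  have hyw := sq_nonneg ‖y w‖
  have hF := freqNormSq_nonneg w.1
  have hP1 : 0 ≤ (if w.1 + (W₁.phase i).m ∈ box R then ‖transversalProj (w.1 + (W₁.phase i).m) (y w)‖ ^ 2 else 0) := by
    split_ifs <;> positivity
  have hP2 : 0 ≤ (if w.1 - (W₁.phase i).m ∈ box R then ‖transversalProj (w.1 - (W₁.phase i).m) (y w)‖ ^ 2 else 0) := by
    split_ifs <;> positivity
  by_cases hw : w.1 ∈ ladder z₀ (W₁.phase i).m
  · have hwp0 : w.1 + (W₁.phase i).m ≠ 0 := ne_zero_of_mem_ladder W₁ i hhop (add_mem_ladder hw)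
    have hwm0 : w.1 - (W₁.phase i).m ≠ 0 := ne_zero_of_mem_ladder W₁ i hhop (sub_mem_ladder hw)
    have hk : kdot w.1 (y w) = 0 := kdot_eq_zero_of_mem_ladderSub hy w
    by_cases hp : w.1 + (W₁.phase i).m ∈ box R
    · by_cases hq : w.1 - (W₁.phase i).m ∈ box R
      · rw [if_pos hp, if_pos hq]
        have hu := LadderCrush.uncertainty_site_lattice (ne_zero_of_mem_box w.2) (W₁.phase i).m hk
        have h0 : 0 ≤ 2 / (1 + freqNormSq (W₁.phase i).m) * (freqNormSq w.1 * ‖y w‖ ^ 2 / ((R : ℝ) - M) ^ 2) := by positivity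
        have e : 2 / (1 + freqNormSq (W₁.phase i).m) * (‖y w‖ ^ 2 - freqNormSq w.1 * ‖y w‖ ^ 2 / ((R : ℝ) - M) ^ 2) =
            2 / (1 + freqNormSq (W₁.phase i).m) * ‖y w‖ ^ 2 - 2 / (1 + freqNormSq (W₁.phase i).m) * (freqNormSq w.1 * ‖y w‖ ^ 2 / ((R : ℝ) - M) ^ 2) := by
          ring
        rw [e]; linarith
      · -- a box end: the weight pays for everything
        have hbd := sq_le_freqNormSq_of_sub_not_mem hq hwm0 hM hMR.le
        have h1 := le_weight_div_of_sq_le hRM hbd hyw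
        have : 2 / (1 + freqNormSq (W₁.phase i).m) * (‖y w‖ ^ 2 - freqNormSq w.1 * ‖y w‖ ^ 2 / ((R : ℝ) - M) ^ 2) ≤ 0 :=
          mul_nonpos_of_nonneg_of_nonpos hc (by linarith)
        linarith
    · have hbd := sq_le_freqNormSq_of_add_not_mem hp hwp0 hM hMR.le
      have h1 := le_weight_div_of_sq_le hRM hbd hyw
      have : 2 / (1 + freqNormSq (W₁.phase i).m) * (‖y w‖ ^ 2 - freqNormSq w.1 * ‖y w‖ ^ 2 / ((R : ℝ) - M) ^ 2) ≤ 0 :=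
        mul_nonpos_of_nonneg_of_nonpos hc (by linarith)
      linarith
  · rw [apply_eq_zero_of_mem_ladderSub hy hw]
    simp

/-- `4a·kc ≤ (2a²/ε)c² + 2ε k²` (Young). [folklore] -/
theorem young_bond_index {a ε c k : ℝ} (hε : 0 < ε) :
    4 * a * (c * k) ≤ 2 * a ^ 2 / ε * c ^ 2 + 2 * ε * k ^ 2 := by
  have h : 0 ≤ (a * c - ε * k) ^ 2 := sq_nonneg _
  have e : 2 * a ^ 2 / ε * c ^ 2 + 2 * ε * k ^ 2 - 4 * a * (c * k) = 2 * (a * c - ε * k) ^ 2 / ε := by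
    field_simp; ring
  have : 0 ≤ 2 * (a * c - ε * k) ^ 2 / ε := by positivity
  linarith

/-- **Scalar assembly of (U)**: real arithmetic of `coercive_ladder` (`ny = ‖y‖²`, `c = ‖Cy‖`, `k = ‖Ky‖`, `H2 = ‖Hy‖²`, `X = ⟪Cy,HKy⟫`,
`T = ⟪Ky,[C,H]y⟫`, `P` = the projection sum, `S = Σ|w|²‖y_w‖²`, `D = ⟪dampL y,y⟫`, `M2 = |m|²`, `ρ = R − M`). [cite: BedrossianCotiZelati2017, §2] -/
theorem coercive_scalar {a ε c k ny H2 X T P S D M2 ρ lo : ℝ} (hε : 0 < ε) (hM2 : 0 ≤ M2)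
    (hρ : 0 < ρ) (hlo : 0 < lo) (hS : 0 ≤ S)
    (hU : 2 / (1 + M2) * (ny - S / ρ ^ 2) ≤ P) (hHC : H2 + c ^ 2 = 2 * a ^ 2 * P) (hHeq : H2 = c ^ 2 + 2 * X - T)
    (hcomm : -(2 * a ^ 2 * 3 / (ρ * (4 * Real.pi ^ 2 * lo)) * D) ≤ T) (hcross : X ≤ c * (2 * a * k)) (hSD : 4 * Real.pi ^ 2 * lo * S ≤ D) :
    4 * a ^ 2 / (1 + M2) * ny ≤ (2 + 2 * a ^ 2 / ε) * c ^ 2 + 2 * ε * k ^ 2 +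
      (2 * a ^ 2 * 3 / (ρ * (4 * Real.pi ^ 2 * lo)) + 4 * a ^ 2 / (4 * Real.pi ^ 2 * lo * ρ ^ 2)) * D := by
  have h2 : 2 * a ^ 2 * (2 / (1 + M2) * (ny - S / ρ ^ 2)) ≤ H2 + c ^ 2 := by
    rw [hHC]; exact mul_le_mul_of_nonneg_left hU (by positivity)
  have h3 : H2 ≤ c ^ 2 + 4 * a * (c * k) + 2 * a ^ 2 * 3 / (ρ * (4 * Real.pi ^ 2 * lo)) * D := by rw [hHeq]; linarith
  have hyoung := young_bond_index (a := a) (c := c) (k := k) hε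
  have hπ : 0 < 4 * Real.pi ^ 2 * lo := by positivity
  have h1 : 4 * a ^ 2 / (1 + M2) ≤ 4 * a ^ 2 := div_le_self (by positivity) (by linarith)
  have hS1 : S ≤ D / (4 * Real.pi ^ 2 * lo) := by rw [le_div_iff₀ hπ]; linarith
  have hS' : S / ρ ^ 2 ≤ D / (4 * Real.pi ^ 2 * lo * ρ ^ 2) := by
    have h := div_le_div_of_nonneg_right hS1 (le_of_lt (pow_pos hρ 2))
    rwa [div_div] at h
  have hbd : 4 * a ^ 2 / (1 + M2) * (S / ρ ^ 2) ≤ 4 * a ^ 2 / (4 * Real.pi ^ 2 * lo * ρ ^ 2) * D := by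
    have hSρ : 0 ≤ S / ρ ^ 2 := by positivity
    calc 4 * a ^ 2 / (1 + M2) * (S / ρ ^ 2) ≤ 4 * a ^ 2 * (S / ρ ^ 2) := mul_le_mul_of_nonneg_right h1 hSρ
      _ ≤ 4 * a ^ 2 * (D / (4 * Real.pi ^ 2 * lo * ρ ^ 2)) := mul_le_mul_of_nonneg_left hS' (by positivity)
      _ = _ := by ring
  have e : 2 * a ^ 2 * (2 / (1 + M2) * (ny - S / ρ ^ 2)) = 4 * a ^ 2 / (1 + M2) * ny - 4 * a ^ 2 / (1 + M2) * (S / ρ ^ 2) := by ring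
  rw [e] at h2
  linarith [h2, h3, hyoung, hbd]

set_option maxHeartbeats 400000 in -- pre-budgeted (ops-buildfix rule): heavy arithmetic, stay above the farm build cliff
/-- **(U) COERCIVITY ON THE LADDER SUBSPACE (hypothesis h5 with the free `ε`).**  On a hopping ladder, box radius `R > M ≥ ‖mᵢ‖_∞`, `NearIso 𝔸 lo' hi'`,
`lo' > 0`, for every `ε > 0`, with `a = 2π|êᵢ·z₀|‖αᵢ‖`, `C = K H − H K`:
`(4a²/(1+|mᵢ|²))·‖y‖² ≤ (2 + 2a²/ε)‖Cy‖² + 2ε‖Ky‖² + (2a²·3/((R−M)·4π²lo') + 4a²/(4π²lo'(R−M)²))·⟪dampL y,y⟫`.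
[cite: BedrossianCotiZelati2017, §2 (spectral gap / uncertainty step)] -/
theorem coercive_ladder (W₁ : LatticeWord k₀) {R : ℕ} (i : Fin k₀) (z₀ : Fin 3 → ℤ)
    (hhop : ∑ a, (W₁.phase i).e a * (z₀ a : ℝ) ≠ 0) {M : ℝ} (hM : ∀ j, |((W₁.phase i).m j : ℝ)| ≤ M) (hMR : M < R)
    {𝔸 : Torus.Visc4 (Fin 3)} {lo' hi' : ℝ} (h𝔸 : Torus.NearIso 𝔸 lo' hi') (hlo' : 0 < lo') (γ₁ : ℝ) {ε : ℝ} (hε : 0 < ε)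
    {y : Space R} (hy : y ∈ ladderSub R (ladder z₀ (W₁.phase i).m)) :
    4 * (2 * Real.pi * |∑ a, (W₁.phase i).e a * (z₀ a : ℝ)| * ‖slotAmp W₁ i‖) ^ 2 / (1 + freqNormSq (W₁.phase i).m) * ‖y‖ ^ 2 ≤
      (2 + 2 * (2 * Real.pi * |∑ a, (W₁.phase i).e a * (z₀ a : ℝ)| * ‖slotAmp W₁ i‖) ^ 2 / ε) *
          ‖indexL R (W₁.phase i).m (hopL W₁ R i y) - hopL W₁ R i (indexL R (W₁.phase i).m y)‖ ^ 2 +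
        2 * ε * ‖indexL R (W₁.phase i).m y‖ ^ 2 +
        (2 * (2 * Real.pi * |∑ a, (W₁.phase i).e a * (z₀ a : ℝ)| * ‖slotAmp W₁ i‖) ^ 2 * 3 / (((R : ℝ) - M) * (4 * Real.pi ^ 2 * lo')) +
            4 * (2 * Real.pi * |∑ a, (W₁.phase i).e a * (z₀ a : ℝ)| * ‖slotAmp W₁ i‖) ^ 2 / (4 * Real.pi ^ 2 * lo' * ((R : ℝ) - M) ^ 2)) *
          ⟪dampL 𝔸 γ₁ R y, y⟫_ℝ := by
  have hRM : 0 < (R : ℝ) - M := by linarith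
  have hU0 := fun w => uncertainty_site_box W₁ i z₀ hhop hM hMR hy w
  have hsum := Finset.sum_le_sum fun w (_ : w ∈ (Finset.univ : Finset (box R))) => hU0 w
  rw [← Finset.mul_sum, Finset.sum_sub_distrib, ← PiLp.norm_sq_eq_of_L2, ← Finset.sum_div] at hsum
  have hHC := norm_sq_hopL_add_norm_sq_bond W₁ i z₀ hy
  have hHeq := norm_sq_hopL_eq W₁ i y
  have hcomm := inner_indexL_commutator_ge W₁ i z₀ hhop hM hMR h𝔸 hlo' γ₁ hy
  have hKyV : indexL R (W₁.phase i).m y ∈ ladderSub R (ladder z₀ (W₁.phase i).m) := indexL_mem_ladderSub _ hy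
  have hHK2 := norm_sq_hopL_le W₁ i z₀ hKyV
  have hHK : ‖hopL W₁ R i (indexL R (W₁.phase i).m y)‖ ≤ 2 * (2 * Real.pi * |∑ a, (W₁.phase i).e a * (z₀ a : ℝ)| * ‖slotAmp W₁ i‖) *
      ‖indexL R (W₁.phase i).m y‖ := by
    refine (abs_le_of_sq_le_sq' ?_ (by positivity)).2
    rw [mul_pow, mul_pow]; linarith
  have hcross := (real_inner_le_norm (indexL R (W₁.phase i).m (hopL W₁ R i y) - hopL W₁ R i (indexL R (W₁.phase i).m y))
    (hopL W₁ R i (indexL R (W₁.phase i).m y))).trans (mul_le_mul_of_nonneg_left hHK (norm_nonneg _))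
  exact coercive_scalar hε (freqNormSq_nonneg _) hRM hlo'
    (Finset.sum_nonneg fun w _ => mul_nonneg (freqNormSq_nonneg _) (sq_nonneg _)) hsum hHC hHeq hcomm hcross
    (real_inner_dampL_ge h𝔸 γ₁ hy)

end Summit.AnomalousDissipation.AnomalousDissipation.Theorems.SolenoidalFractalHomogenisation.LagrangianStep.Sideband

end
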